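import Summits.SmoothPoincare4.SmoothPoincare4.Theorems.SymplecticOrigamiOrigamiFoldExistenceStubOuterCleanRecognitionChartSide

/-!
# Stub `stub_outerSideLemma` of line `shadow-pleats` for crux `OrigamiFoldExistence` — γ:
# the O1-FREE outer-collar package with its side sign
(item stmt-SmoothPoincare4-7844, route SymplecticOrigami; seat c5, complementary lead on O1)

Helper file towards the registered stub `stub_outerSideLemma : OuterSideLemma` (the side lemma
(O1) of file F, `…StubOuterCleanRecognitionChartSide`), which the lead (seat c5) proves by
coverings and Brown's theorem instead of degree theory (`SideLemma-covering-c5.md`).  That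
proof starts from the FIRST-ORDER structure of the outer fold collar of an outer-clean chart —
c3's files C–E (`…ChartShell`, `…ChartRay`, `…ChartCollar`) — which is O1-free: it is exactly
what file F's `nonempty_collarData` establishes BEFORE it invokes its hypothesis
`hO : OuterSideLemma` to identify the outer sign with the pole sign.  Here that O1-free half is
packaged over the line vocabulary, with the sign left free:

* **`exists_collarSide`** (registered helper) — for a `1`-chart pleated position with
  outer-clean chart `G = proj5 ∘ ι ∘ e 0` and tube data `D` of the lifted outer crease
  `liftedCrease ι (e 0) = λ ∘ radialSphere G 2`, there are a width `κ ∈ (0, 1]`, a height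
  `t₀ ∈ (0, 1/4]` and a SIGN `s = ±1` with: `G` injective on the thin closed collar
  `{2 ≤ ‖u‖ < 2 + κ}` (thin-collar injectivity, `StrShell.injOn_outerCollar_of_sign`); the open
  collar lifted into the open side `{s · D.sideFun > 0}` of the crease (one-sidedness in the
  tube, `StrShell.liftS4_apply_mem_tube_side`, read through the tree's side function:
  `D.sideFun (D.τ (x, t • e₀)) = t` for `|t| ≤ 1/4`, `sideFun_tube_eq_height`, on a good shell
  with fibre heights `≤ 1/4`, `StrShell.exists_strShell_abs_tubeT_le`); and local surjectivity
  onto that side up to height `t₀` (`StrShell.exists_height_localSurj`).  The sign is the OUTER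
  SIGN of the fibre height (`StrShell.exists_outerSign`); file ε of the lead shows
  `s = poleSign D`, i.e. (O1).

Pattern: the first half of the proof of `nonempty_collarData` (file F), verbatim up to the
`hO` step, plus the conversion fibre-height sign ⇒ side-function sign (`TubeData.sideFun_collar`,
`satProfile_eq_self`, as in `sideσ_tube` of file A).

Sources: the lead's `SideLemma-covering-c5.md` §2; `OuterClean-analysis-c3.md` §2 (O1), §3 (O2);
M. W. Hirsch, *Differential Topology* (1976), Ch. 4 §5–§6 (tubular neighbourhoods).
-/

noncomputable section

-- the prescribed namespace `Summit.<P>.<Sub>.…` duplicates `SmoothPoincare4` (P = Sub)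
set_option linter.dupNamespace false

open scoped Manifold ContDiff Topology RealInnerProductSpace
open Set Function Filter Metric
open Literature.Topology.FourManifolds Literature.Topology.FourManifolds.SphereHypersurfaceSides

namespace Summit.SmoothPoincare4.SmoothPoincare4.Theorems.OrigamiFoldExistence.ShadowPleats

/-! ### The side function in the tube, near the core -/

/-- Near the core of the tube of a hypersurface `3`-sphere in `S⁴` the tree's side function IS
the fibre height: `D.sideFun (D.τ (x, t • e₀)) = t` for `|t| ≤ 1/4` (the tube point is the
collar point `D.collar (x, t)`, where the side function is the saturated height `β t = t`).
Compare `sideσ_tube` (file A), which carries the extra pole sign. -/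
theorem sideFun_tube_eq_height
    {f : Metric.sphere (0 : EuclideanSpace ℝ (Fin 4)) 1 → Metric.sphere (0 : EuclideanSpace ℝ (Fin 5)) 1}
    (D : TubeData f) (x : Metric.sphere (0 : EuclideanSpace ℝ (Fin 4)) 1) {t : ℝ} (ht : |t| ≤ 1 / 4) :
    D.sideFun (D.τ (x, t • SphereHypersurfaceSides.e₀)) = t := by
  have ht' : t ∈ Icc (-1 : ℝ) 1 := by
    constructor <;> linarith [(abs_le.1 ht).1, (abs_le.1 ht).2]
  rw [show D.τ (x, t • SphereHypersurfaceSides.e₀) = D.collar (x, ⟨t, ht'⟩) from rfl,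
    D.sideFun_collar (by norm_num), satProfile_eq_self ht]

/-! ### The O1-free collar package -/

section CollarSide

variable {M : Type} [TopologicalSpace M] [ChartedSpace (EuclideanSpace ℝ (Fin 4)) M]
  {ι : M → EuclideanSpace ℝ (Fin 5)} {δ : ℝ} {e : Fin 1 → EuclideanSpace ℝ (Fin 4) → M}

/-- **THE OUTER COLLAR AND ITS SIDE (O1-free)** (registered helper of file γ).  For a `1`-chart
pleated position with outer-clean chart and tube data `D` of the lifted outer crease there are
a width `κ ∈ (0,1]`, a height `t₀ ∈ (0, 1/4]` and a SIGN `s = ±1` such that: the chart shadow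
`G = proj5 ∘ ι ∘ e 0` is injective on the closed thin collar `{2 ≤ ‖u‖ < 2 + κ}`; the open
collar is lifted into the open side `{s · D.sideFun > 0}` of the crease; and every tube point
`D.τ (x, t • e₀)` with `0 ≤ s t ≤ t₀` is the lifted shadow of a collar point `u`,
`2 ≤ ‖u‖ ≤ 2 + κ/2`.  [The first half of `nonempty_collarData` (file F) without the side lemma:
a good shell with fibre heights `≤ 1/4` (files C, E), the chart shadow immersive off the fold
spheres, the outer sign of the fibre height (file D), thin-collar injectivity, one-sidedness in
the tube and local surjectivity (file E); in the tube near the core the side function is the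
fibre height (`sideFun_tube_eq_height`).  Outer-cleanness `_hclean` is what makes the lifted
crease an embedding, i.e. what makes tube data `D` exist; given `D` it is not used again.]
[folklore] -/
theorem exists_collarSide (hpos : IsPleatedPosition ι δ e)
    (_hclean : Set.InjOn (proj5 ∘ ι ∘ e 0) (Metric.sphere 0 2)) (D : TubeData (liftedCrease ι (e 0))) :
    ∃ κ t₀ s : ℝ, 0 < κ ∧ κ ≤ 1 ∧ 0 < t₀ ∧ t₀ ≤ 1 / 4 ∧ (s = 1 ∨ s = -1) ∧
      Set.InjOn (proj5 ∘ ι ∘ e 0) {u | 2 ≤ ‖u‖ ∧ ‖u‖ < 2 + κ} ∧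
      (∀ u : EuclideanSpace ℝ (Fin 4), 2 < ‖u‖ → ‖u‖ < 2 + κ →
        0 < s * D.sideFun (liftS4 ((proj5 ∘ ι ∘ e 0) u))) ∧
      (∀ (x : Metric.sphere (0 : EuclideanSpace ℝ (Fin 4)) 1) (t : ℝ), 0 ≤ s * t → s * t ≤ t₀ →
        ∃ u : EuclideanSpace ℝ (Fin 4), 2 ≤ ‖u‖ ∧ ‖u‖ ≤ 2 + κ / 2 ∧
          liftS4 ((proj5 ∘ ι ∘ e 0) u) = D.τ (x, t • SphereHypersurfaceSides.e₀)) := by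
  set G := proj5 ∘ ι ∘ e 0 with hGdef
  have hG : ContDiff ℝ ∞ G := contDiff_chartShadow hpos
  -- a good shell of width `≤ 1` with small fibre heights
  obtain ⟨h₁⟩ := nonempty_strShell (G := G) D hG
  obtain ⟨h, -, habs⟩ := h₁.exists_strShell_abs_tubeT_le hG
  -- the chart shadow is immersive on the open outer collar of the shell
  have himm : ∀ u : EuclideanSpace ℝ (Fin 4), 2 < ‖u‖ → ‖u‖ < 2 + h.κ → Injective (fderiv ℝ G u) :=
    fun u hu1 hu2 => injective_fderiv_chartShadow_outer hpos hu1 (by linarith [h.le_one])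
  -- the outer sign of the fibre height, and local surjectivity onto that side
  obtain ⟨s, hs, hsign⟩ := h.exists_outerSign hG himm
  obtain ⟨t₀, ht₀, hsurj⟩ := h.exists_height_localSurj hG himm hs hsign
  refine ⟨h.κ, min t₀ (1 / 4), s, h.pos, h.le_one, lt_min ht₀ (by norm_num), min_le_right _ _, hs,
    h.injOn_outerCollar_of_sign hG himm hs hsign, fun u hu1 hu2 => ?_,
    fun x t ht0 ht1 => hsurj x t ht0 (ht1.trans (min_le_left _ _))⟩
  -- one-sidedness in the tube, read through the side function (`= fibre height` near the core)
  obtain ⟨hτ, hst⟩ := h.liftS4_apply_mem_tube_side hsign hu1 hu2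
  have hushell : u ∈ foldShell h.κ := ⟨by linarith [h.pos], hu2⟩
  rw [hτ, sideFun_tube_eq_height D (tubeW D u) (habs u hushell)]
  exact hst

end CollarSide

end Summit.SmoothPoincare4.SmoothPoincare4.Theorems.OrigamiFoldExistence.ShadowPleats

end
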